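import Summits.Ventures.HodgeRepro2.T5SU11WeightedSpaceGroundState

/-!
# The resolvent as a power series in `μ` on the ground-state weighted space `W_1`, on the sharp disc

Row 557's Neumann remainder bound on `W_1 = {|g| ≤ D Ξ}` makes `G^I_λ g(t)` the SUM of the power series
`Σ_k (μ − μ₂)^k (G^I_{λ₂})^{k+1} g(t)` on the sharp disc `|μ − μ₂| < (λ₂ − 1)²`: the terms are geometrically bounded
(`|(μ − μ₂)^k (G^I_{λ₂})^{k+1} g(t)| ≤ (|μ − μ₂|/(λ₂ − 1)²)^k D Ξ(t)/(λ₂ − 1)²`), so the series is absolutely summable and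
its partial sums converge to `G^I_λ g(t)`:

* `abs_neumann_term_le` — the geometric bound of the terms;
* `summable_neumann_weighted_one` — **the series is (absolutely) summable** at every `t > 0`;
* `hasSum_neumann_weighted_one`, `tsum_neumann_weighted_one` — **`∑' k, (μ − μ₂)^k (G^I_{λ₂})^{k+1} g(t) = G^I_λ g(t)`** —
  the resolvent `μ ↦ (L − μ)⁻¹ g` is analytic on the disc of radius `dist(μ₂, −ρ²)` about every `μ₂ > −1`, at every point.

Nothing is claimed about (N).

Blind lane: Mathlib + the HodgeRepro2 prefix only; no sorry; axioms ⊆ {propext, Classical.choice,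
Quot.sound}.
-/

namespace Summit.Ventures.HodgeRepro2.T5SU11ResolventPowerSeriesGroundState

open Filter Topology MeasureTheory
open Set (Ioi Ioc)
open T5SU11Cartan T5SU11SphericalFunction T5SU11SphericalDecay T5SU11RadialGreenImproper
  T5SU11ResolventGroundStateWeight T5SU11WeightedSpaceGroundState

section measure

variable [MeasurableSpace Circle] [BorelSpace Circle]

variable {lam lam₂ : ℝ} (hlam : 1 < lam) (hlam₂ : 1 < lam₂) {g : ℝ → ℝ} (hg : ContinuousOn g (Ioi 0))
  {D : ℝ} (hD : ∀ s, 0 < s → |g s| ≤ D * sph 1 (hyp s))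

include hlam₂ hg hD in
/-- **The terms of the Neumann series are geometrically bounded on `W_1`**:
`|(μ − μ₂)^k (G^I_{λ₂})^{k+1} g(t)| ≤ (|μ − μ₂|/(λ₂ − 1)²)^k · D Ξ(t)/(λ₂ − 1)²`. -/
theorem abs_neumann_term_le (k : ℕ) {t : ℝ} (ht : 0 < t) :
    |(lam * (lam - 2) - lam₂ * (lam₂ - 2)) ^ k * (greenSolI (fun t => sph lam₂ (hyp t)) (sphDecay lam₂))^[k + 1] g t|
      ≤ (|lam * (lam - 2) - lam₂ * (lam₂ - 2)| / (lam₂ - 1) ^ 2) ^ k * (D * sph 1 (hyp t) / (lam₂ - 1) ^ 2) := by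
  have hp : 0 < (lam₂ - 1) ^ 2 := by
    have : 0 < lam₂ - 1 := by linarith
    positivity
  have hb := (iterate_mem_weighted_one hlam₂ hg hD (k + 1)).2 t ht
  rw [abs_mul, abs_pow]
  calc |lam * (lam - 2) - lam₂ * (lam₂ - 2)| ^ k
        * |((greenSolI (fun t => sph lam₂ (hyp t)) (sphDecay lam₂))^[k + 1] g) t|
      ≤ |lam * (lam - 2) - lam₂ * (lam₂ - 2)| ^ k * (D * sph 1 (hyp t) / ((lam₂ - 1) ^ 2) ^ (k + 1)) :=
        mul_le_mul_of_nonneg_left hb (pow_nonneg (abs_nonneg _) _)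
    _ = (|lam * (lam - 2) - lam₂ * (lam₂ - 2)| / (lam₂ - 1) ^ 2) ^ k * (D * sph 1 (hyp t) / (lam₂ - 1) ^ 2) := by
        rw [div_pow, pow_succ]
        field_simp

include hlam₂ hg hD in
/-- **The Neumann series is absolutely summable on the sharp disc** `|μ − μ₂| < (λ₂ − 1)²`, at every `t > 0`. -/
theorem summable_neumann_weighted_one (hq : |lam * (lam - 2) - lam₂ * (lam₂ - 2)| < (lam₂ - 1) ^ 2) {t : ℝ} (ht : 0 < t) :
    Summable (fun k : ℕ => (lam * (lam - 2) - lam₂ * (lam₂ - 2)) ^ k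
      * (greenSolI (fun t => sph lam₂ (hyp t)) (sphDecay lam₂))^[k + 1] g t) := by
  have hp : 0 < (lam₂ - 1) ^ 2 := by
    have : 0 < lam₂ - 1 := by linarith
    positivity
  set q := |lam * (lam - 2) - lam₂ * (lam₂ - 2)| / (lam₂ - 1) ^ 2 with hq_def
  have hq0 : 0 ≤ q := by positivity
  have hq1 : q < 1 := by rw [hq_def, div_lt_one hp]; exact hq
  have hgeom : Summable (fun k : ℕ => q ^ k * (D * sph 1 (hyp t) / (lam₂ - 1) ^ 2)) :=
    (summable_geometric_of_lt_one hq0 hq1).mul_right _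
  refine Summable.of_norm_bounded hgeom (fun k => ?_)
  rw [Real.norm_eq_abs]
  exact abs_neumann_term_le hlam₂ hg hD k ht

include hlam hlam₂ hg hD in
/-- **THE RESOLVENT IS THE SUM OF ITS NEUMANN SERIES ON `W_1`**: for `|μ − μ₂| < (λ₂ − 1)²` and every `t > 0`,
`HasSum (fun k => (μ − μ₂)^k (G^I_{λ₂})^{k+1} g(t)) (G^I_λ g(t))`. -/
theorem hasSum_neumann_weighted_one (hq : |lam * (lam - 2) - lam₂ * (lam₂ - 2)| < (lam₂ - 1) ^ 2) {t : ℝ} (ht : 0 < t) :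
    HasSum (fun k : ℕ => (lam * (lam - 2) - lam₂ * (lam₂ - 2)) ^ k
      * (greenSolI (fun t => sph lam₂ (hyp t)) (sphDecay lam₂))^[k + 1] g t)
      (greenSolI (fun t => sph lam (hyp t)) (sphDecay lam) g t) := by
  have hs := summable_neumann_weighted_one (lam := lam) hlam₂ hg hD hq ht
  rw [hs.hasSum_iff_tendsto_nat]
  obtain ⟨hlim, hrem⟩ := tendsto_neumann_weighted_one hlam hg hD hlam₂ hq
  set a := greenSolI (fun t => sph lam (hyp t)) (sphDecay lam) g t with ha
  set S : ℕ → ℝ := fun n => ∑ k ∈ Finset.range n, (lam * (lam - 2) - lam₂ * (lam₂ - 2)) ^ k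
    * (greenSolI (fun t => sph lam₂ (hyp t)) (sphDecay lam₂))^[k + 1] g t with hS
  -- `a − S(n+1) → 0` by the remainder bound, hence `S(n+1) → a`, hence `S n → a`
  have hbound : Tendsto (fun n : ℕ => (|lam * (lam - 2) - lam₂ * (lam₂ - 2)| / (lam₂ - 1) ^ 2) ^ (n + 1)
      * (D / (lam - 1) ^ 2) * sph 1 (hyp t)) atTop (𝓝 0) := by
    have h := hlim.mul_const (sph 1 (hyp t))
    rwa [zero_mul] at h
  have h1 : Tendsto (fun n : ℕ => a - S (n + 1)) atTop (𝓝 0) :=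
    squeeze_zero_norm (fun n => by rw [Real.norm_eq_abs]; exact hrem n t ht) hbound
  have h2 : Tendsto (fun n : ℕ => S (n + 1)) atTop (𝓝 a) := by
    have h := h1.neg
    rw [neg_zero] at h
    have h' : Tendsto (fun n : ℕ => S (n + 1) - a) atTop (𝓝 0) := by
      refine h.congr (fun n => ?_)
      ring
    exact tendsto_sub_nhds_zero_iff.mp h'
  exact (tendsto_add_atTop_iff_nat 1).mp h2

include hlam hlam₂ hg hD in
/-- **`∑' k, (μ − μ₂)^k (G^I_{λ₂})^{k+1} g(t) = G^I_λ g(t)`** on the sharp disc, at every `t > 0`. -/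
theorem tsum_neumann_weighted_one (hq : |lam * (lam - 2) - lam₂ * (lam₂ - 2)| < (lam₂ - 1) ^ 2) {t : ℝ} (ht : 0 < t) :
    ∑' k : ℕ, (lam * (lam - 2) - lam₂ * (lam₂ - 2)) ^ k
      * (greenSolI (fun t => sph lam₂ (hyp t)) (sphDecay lam₂))^[k + 1] g t
      = greenSolI (fun t => sph lam (hyp t)) (sphDecay lam) g t :=
  (hasSum_neumann_weighted_one hlam hlam₂ hg hD hq ht).tsum_eq

end measure

end Summit.Ventures.HodgeRepro2.T5SU11ResolventPowerSeriesGroundState
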